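import Summits.HubbardSuperconductivity.HubbardSuperconductivity.Theorems.AnisotropyChordTransferFibre3Shell

/-!
# Route `AnisotropyChord` / H0 rotor rung: the shell/Dirichlet-form bound in EVERY `K` fibre

`…TransferFibre3Dirichlet`/`…TransferFibre3Shell` prove `Σ_c W(c)‖Y c‖² ≤ Re⟨Y, H₀Y⟩` for the `K₁` fibre (`ShellDirichletBound`).
The argument only uses `|e^{iK·e}| = 1`, so it holds in every fibre `K`; this file records the general-`K` versions
(`re_hopSum_le_K`, `re_ip_H0apply_ge_cnt_K`, **`shell_le_dirichlet_K`**), needed at `K = 0` for the positivity of the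
Jastrow–Feynman Rayleigh quotient `T⁺ = RQ₀(Π⁰)` (`…Fibre3GroundState`; memo ROTOR-THEORY-21 §301 STEP 0).
Prover seat `hubbard-h0-rotor-p1` g22; helper for stmt-HubbardSuperconductivity-19089 (`--supports`).
-/

set_option linter.dupNamespace false
set_option autoImplicit false

noncomputable section

open scoped BigOperators
open Complex

namespace Summit.HubbardSuperconductivity.HubbardSuperconductivity.Theorems.AnisotropyChord.Transfer.Fibre3

variable (L : ℕ) [NeZero L]

/-- the real part of a directional hopping form in the `K` fibre, bounded by the three hop types. [folklore] -/
theorem re_hopSum_le_K (K : Tor L) (Y : Cfg L → ℂ) (hY : ∀ c, InD L c = true → Y c = 0) (e : Tor L) :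
    (hopSum L K Y Y e).re ≤ (1 / 2) * ∑ c : Cfg L, ‖Y c‖ ^ 2 * wt L e c := by
  unfold hopSum
  have p1 : ∀ c : Cfg L, (c.1 + e, c.2) = c + (e, 0) := fun c => by ext <;> simp
  have p2 : ∀ c : Cfg L, (c.1, c.2 + e) = c + (0, e) := fun c => by ext <;> simp
  have p3 : ∀ c : Cfg L, (c.1 - e, c.2 - e) = c + (-e, -e) := fun c => by ext <;> simp [sub_eq_add_neg]
  simp_rw [p1, p2, p3, mul_add, Finset.sum_add_distrib, Complex.add_re]
  have h1 := re_hop_le L Y hY ((e, 0) : Cfg L) 1 (by simp)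
  have h2 := re_hop_le L Y hY ((0, e) : Cfg L) 1 (by simp)
  have h3 := re_hop_le L Y hY ((-e, -e) : Cfg L) (phase L K e) (norm_phase L K e)
  simp only [one_mul] at h1 h2
  have hw : ∑ c : Cfg L, ‖Y c‖ ^ 2 * wt L e c
      = (∑ c : Cfg L, ‖Y c‖ ^ 2 * (1 - Dind L (c + (e, 0))) + ∑ c : Cfg L, ‖Y c‖ ^ 2 * (1 - Dind L (c - (e, 0))))
        + (∑ c : Cfg L, ‖Y c‖ ^ 2 * (1 - Dind L (c + (0, e))) + ∑ c : Cfg L, ‖Y c‖ ^ 2 * (1 - Dind L (c - (0, e))))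
        + (∑ c : Cfg L, ‖Y c‖ ^ 2 * (1 - Dind L (c + (-e, -e)))
            + ∑ c : Cfg L, ‖Y c‖ ^ 2 * (1 - Dind L (c - (-e, -e)))) := by
    unfold wt; simp only [mul_add, Finset.sum_add_distrib]
  rw [hw]; linarith

/-- **hopping-form lower bound in the `K` fibre:** `Re⟨Y, H₀^K Y⟩ ≥ ½ Σ_c cnt(c)‖Y c‖²` for `Y` vanishing on `D`. [folklore] -/
theorem re_ip_H0apply_ge_cnt_K (K : Tor L) (Y : Cfg L → ℂ) (hY : ∀ c, InD L c = true → Y c = 0) :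
    (1 / 2) * ∑ c : Cfg L, cnt L c * ‖Y c‖ ^ 2 ≤ (ip L Y (H0apply L K Y)).re := by
  rw [ip_H0apply]
  have hN : (ip L Y Y).re = ∑ c : Cfg L, ‖Y c‖ ^ 2 := ip_self_re L Y
  have h1 := re_hopSum_le_K L K Y hY (ex L)
  have h2 := re_hopSum_le_K L K Y hY (-ex L)
  have h3 := re_hopSum_le_K L K Y hY (ey L)
  have h4 := re_hopSum_le_K L K Y hY (-ey L)
  have key : ∑ c : Cfg L, ‖Y c‖ ^ 2 * wt L (ex L) c + ∑ c : Cfg L, ‖Y c‖ ^ 2 * wt L (-ex L) c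
      + ∑ c : Cfg L, ‖Y c‖ ^ 2 * wt L (ey L) c + ∑ c : Cfg L, ‖Y c‖ ^ 2 * wt L (-ey L) c
      = 24 * ∑ c : Cfg L, ‖Y c‖ ^ 2 - 2 * ∑ c : Cfg L, cnt L c * ‖Y c‖ ^ 2 := by
    rw [← Finset.sum_add_distrib, ← Finset.sum_add_distrib, ← Finset.sum_add_distrib, Finset.mul_sum, Finset.mul_sum,
      ← Finset.sum_sub_distrib]
    refine Finset.sum_congr rfl fun c _ => ?_
    have := wt_sum_eq L c
    calc ‖Y c‖ ^ 2 * wt L (ex L) c + ‖Y c‖ ^ 2 * wt L (-ex L) c + ‖Y c‖ ^ 2 * wt L (ey L) c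
          + ‖Y c‖ ^ 2 * wt L (-ey L) c
        = ‖Y c‖ ^ 2 * (wt L (ex L) c + wt L (-ex L) c + wt L (ey L) c + wt L (-ey L) c) := by ring
      _ = 24 * ‖Y c‖ ^ 2 - 2 * (cnt L c * ‖Y c‖ ^ 2) := by rw [this]; ring
  have eH : (6 * ip L Y Y - (1 / 2 : ℂ) * (hopSum L K Y Y (ex L) + hopSum L K Y Y (-ex L)
      + hopSum L K Y Y (ey L) + hopSum L K Y Y (-ey L))).re
      = 6 * ∑ c : Cfg L, ‖Y c‖ ^ 2 - (1 / 2) * ((hopSum L K Y Y (ex L)).re + (hopSum L K Y Y (-ex L)).re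
          + (hopSum L K Y Y (ey L)).re + (hopSum L K Y Y (-ey L)).re) := by
    rw [← hN]; simp only [Complex.sub_re, Complex.mul_re, Complex.add_re]; norm_num
  rw [eH]
  linarith

/-- **the shell/Dirichlet-form bound in every fibre:** `Σ_c W(c)‖Y c‖² ≤ Re⟨Y, H₀^K Y⟩` for `Y` vanishing on the hard
core (in particular at `K = 0`). [folklore] -/
theorem shell_le_dirichlet_K (K : Tor L) (Y : Cfg L → ℂ) (hY : ∀ c, InD L c = true → Y c = 0) :
    (∑ c : Cfg L, (Wcount L c : ℝ) * ‖Y c‖ ^ 2) ≤ (ip L Y (H0apply L K Y)).re := by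
  refine le_trans ?_ (re_ip_H0apply_ge_cnt_K L K Y hY)
  rw [Finset.mul_sum]
  apply Finset.sum_le_sum
  intro c _
  by_cases hc : InD L c = true
  · rw [hY c hc]; simp
  · have hc' : InD L c = false := by simpa using hc
    have h2 := two_Wcount_le_cnt L c hc'
    nlinarith [sq_nonneg ‖Y c‖]

end Summit.HubbardSuperconductivity.HubbardSuperconductivity.Theorems.AnisotropyChord.Transfer.Fibre3

end
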